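import Literature.MathematicalPhysics.KineticTheory.LambertianRedrawNondegenerate
import Literature.MathematicalPhysics.KineticTheory.HardSphereEuler
import HarnessLib

/-!
# `LambertianEuler` (stmt-AtomisticToContinuum-11854), line `Sketch`, stub `stub_tailsLambda`:
# the `k = 1` rung — the kinetic energy never increases along the Lambertian flow, in expectation

Registered sub-goal `lambertFlow_energyRung` of the research-grade stub `stub_tailsLambda`
(`TailsLambda`, skeleton `Cruxes/LambertianEuler/Lines/Sketch.lean`): for `0 ≤ σ < 1/2`, every
`N`, every initial law `P` on the `(N+1)`-sphere phase space over `𝕋³` and every time `s`,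

  `∫ (N+1)⁻¹ ∑ᵢ ‖vᵢ(Λ_s(z, ξ))‖² d(P ⊗ γ^ℕ)(z, ξ) ≤ ∫ (N+1)⁻¹ ∑ᵢ ‖vᵢ‖² dP(z)`,

where `Λ_s(z, ξ) = lambertFlow (Torus.geometry (Fin 3)) (hsDiameter σ N) ξ z s` is the Lambertian
hard-sphere flow driven by the noise sequence `ξ ∼ γ^ℕ = lambertNoise (Fin 3)`.  This is the first
(`k = 1`) rung of the moment ladder `E[(N+1)⁻¹ ∑ᵢ ‖vᵢ(Λ_s)‖^{2k}]`; unlike the higher rungs it is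
free of any collision statistics.

## Proof

Pathwise, the Lambertian redraw never increases the kinetic energy of the colliding pair (it
conserves it at non-degenerate contacts and dissipates the approaching component at the
degenerate ones), and free flight keeps the velocities, so
`configEnergy (Λ_s(z, ξ)) ≤ configEnergy z` for EVERY `(z, ξ, s)`
(`configEnergy_lambertFlow_le`, `configEnergy z = ½ ∑ᵢ ‖vᵢ‖²`).  Integrate: the lower integral
against `P.prod γ^ℕ` is at most the iterated one (`MeasureTheory.lintegral_prod_le`, valid for an
arbitrary first factor and without measurability), the inner integrand is dominated by a function
of `z` alone, and `γ^ℕ` is a probability measure (`isProbabilityMeasure_lambertNoise`).  The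
density hypotheses `0 ≤ σ < 1/2` of the registered signature are not used by this argument.

References: A. V. Bobylev, J. Stat. Phys. 88 (1997) (moment inequalities / Povzner ladder, of
which this is the trivial rung); C. Cercignani, R. Illner, M. Pulvirenti, *The Mathematical
Theory of Dilute Gases* (1994), §4.2.
-/

noncomputable section

open scoped BigOperators Topology ENNReal InnerProductSpace
open MeasureTheory ProbabilityTheory Filter Set
open Literature.MathematicalPhysics.KineticTheory
open Literature.Analysis.FluidPDE

namespace Summit.AtomisticToContinuum.HydrodynamicLimit.Theorems.LambertianContactSwapLambertianEulerEnergyRung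

/-- Pathwise rung: the empirical second velocity moment never increases along the Lambertian
flow, `(N+1)⁻¹ ∑ᵢ ‖vᵢ(Λ_s(z, ξ))‖² ≤ (N+1)⁻¹ ∑ᵢ ‖vᵢ‖²` for every noise sequence, datum and time
(`configEnergy_lambertFlow_le`), in `ℝ≥0∞`. [folklore] -/
theorem ofReal_avg_norm_sq_lambertFlow_le {σ : ℝ} (N : ℕ)
    (ξ : ℕ → EuclideanSpace ℝ (Fin 3)) (z : Config (N + 1) (Fin 3) T3) (s : ℝ) :
    ENNReal.ofReal (((N : ℝ) + 1)⁻¹ * ∑ i,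
        ‖(lambertFlow (Torus.geometry (Fin 3)) (hsDiameter σ N) ξ z s i).2‖ ^ 2) ≤
      ENNReal.ofReal (((N : ℝ) + 1)⁻¹ * ∑ i, ‖(z i).2‖ ^ 2) := by
  refine ENNReal.ofReal_le_ofReal (mul_le_mul_of_nonneg_left ?_ (by positivity))
  have h := configEnergy_lambertFlow_le (G := Torus.geometry (Fin 3)) (ε := hsDiameter σ N) ξ z s
  simp only [configEnergy] at h
  linarith

/-- **The `k = 1` rung of the moment ladder along the Lambertian flow.**  For `0 ≤ σ < 1/2`,
every `N`, every law `P` of the initial configuration and every time `s`, the expected empirical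
second velocity moment of `Λ_s` under `P ⊗ γ^ℕ` is at most its initial value under `P`:
pathwise energy monotonicity (`configEnergy_lambertFlow_le`), `lintegral_prod_le` (no
s-finiteness or measurability needed) and `γ^ℕ(univ) = 1`.  Registered sub-goal of
`stub_tailsLambda` (line `Sketch` of crux `LambertianEuler`). [folklore] -/
theorem lambertFlow_energyRung :
    ∀ {σ : ℝ}, 0 ≤ σ → σ < 2⁻¹ → ∀ (N : ℕ) (P : Measure (Config (N + 1) (Fin 3) T3)) (s : ℝ),
      ∫⁻ p, ENNReal.ofReal (((N : ℝ) + 1)⁻¹ * ∑ i,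
          ‖(lambertFlow (Torus.geometry (Fin 3)) (hsDiameter σ N) p.2 p.1 s i).2‖ ^ 2)
        ∂(P.prod (lambertNoise (Fin 3))) ≤
      ∫⁻ z, ENNReal.ofReal (((N : ℝ) + 1)⁻¹ * ∑ i, ‖(z i).2‖ ^ 2) ∂P := by
  intro σ _ _ N P s
  calc ∫⁻ p, ENNReal.ofReal (((N : ℝ) + 1)⁻¹ * ∑ i,
          ‖(lambertFlow (Torus.geometry (Fin 3)) (hsDiameter σ N) p.2 p.1 s i).2‖ ^ 2)
        ∂(P.prod (lambertNoise (Fin 3)))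
      ≤ ∫⁻ z, ∫⁻ ξ, ENNReal.ofReal (((N : ℝ) + 1)⁻¹ * ∑ i,
          ‖(lambertFlow (Torus.geometry (Fin 3)) (hsDiameter σ N) ξ z s i).2‖ ^ 2)
            ∂(lambertNoise (Fin 3)) ∂P := lintegral_prod_le _
    _ ≤ ∫⁻ z, ∫⁻ _ξ, ENNReal.ofReal (((N : ℝ) + 1)⁻¹ * ∑ i, ‖(z i).2‖ ^ 2)
            ∂(lambertNoise (Fin 3)) ∂P :=
        lintegral_mono fun z => lintegral_mono fun ξ => ofReal_avg_norm_sq_lambertFlow_le N ξ z s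
    _ = ∫⁻ z, ENNReal.ofReal (((N : ℝ) + 1)⁻¹ * ∑ i, ‖(z i).2‖ ^ 2) ∂P := by
        simp only [lintegral_const, measure_univ, mul_one]

end Summit.AtomisticToContinuum.HydrodynamicLimit.Theorems.LambertianContactSwapLambertianEulerEnergyRung

end
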